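import Summits.BirchSwinnertonDyer.BirchSwinnertonDyer.Theorems.AdditiveKolyvaginRoadKolyvaginJumpAdapter
import Summits.BirchSwinnertonDyer.BirchSwinnertonDyer.Theorems.AdditiveKolyvaginRoadKolyvaginLocalH1Card
import Summits.BirchSwinnertonDyer.BirchSwinnertonDyer.Theorems.AdditiveKolyvaginRoadInductionOfLevelSystemsDict
import Summits.BirchSwinnertonDyer.Rank1Residual.X11b.KummerRelaxedStructures
import Summits.BirchSwinnertonDyer.Rank1Residual.X11b.KummerPoitouTateExact
import Summits.BirchSwinnertonDyer.Rank1Residual.X11b.BDPRouteSelmerLevelBound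
import Summits.BirchSwinnertonDyer.Rank1Residual.GaloisImage.LocalEulerPoincareCharacteristicHolds
import HarnessLib

/-!
# Route `AdditiveKolyvaginRoad`, crux `KolyvaginPrimitiveAdditive` (item stmt-BirchSwinnertonDyer-20132), stub LOC,
# towards (Supply) at a general prime `p` — the (J) binder `hjump` from TWO local Lagrangian inputs: the Poitou–Tate
# model Selmer structures CONSTRUCTED (p-generic port of koly3b's `…ZhangSupplyJumpStructures` §2, `3 ↦ p`,
# ordinary ↦ TORIC, unipotent-admissible ↦ Bertolini–Darmon admissible (`AdmQ`), `GoodLevel` dropped)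
# (cell `pub/bsd-wall`, lead prover `bsd-wall-akr-p1` g4; `--supports stmt-BirchSwinnertonDyer-20132`, helper)

WHAT. `hjump_of_localLagrangiansP`: the binder `hjump` of the signed (Supply) (koly3b part XIII shape, general `p`, toric
level conditions) at every NON-EMPTY admissible level `n`, Kolyvagin `ℓ ∉ T`, from `IsImaginaryQuadratic K`, the named PT
fact `poitouTate_selmerStructure_duality K`, the places `plK` of the Kolyvagin primes, and two families of GENUINE local
conditions `Ltor v`, `Ltr v ≤ H¹(K_v, E[p])` with, for each: isotropy for the local Weil cup product of every Weil-type
pairing on `E[p]`, the LOWER count `#H¹(K_v, E[p]) ≤ #L · #L`, and the one-sided dictionary with the global-currency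
condition (`toricLocalKer` above the primes of the level ∕ `transverseLocalKerP` at the `plK ℓ'`). Construction VERBATIM
koly3b's: `𝓕 ∕ 𝓖 :=` Kummer at `∞` and off `λ ∪ plK(T) ∪ {v ∣ n}`, `Ltr` on `plK(T)`, `Ltor` above `n`, `⊥ ∕ ⊤` at
`λ = plK ℓ`; side conditions: `T′ := {v ∣ p} ∪ {bad} ∪ {λ} ∪ plK(T) ∪ {v ∣ n}`, unramifiedness of `E[p]` off `T′`
(X11b), finiteness (`kummerOutside`), the Lagrangian property at the Kummer places (X11b
`annRight_invWeilPairing_kummerSelmerStructure_eq` + Tate's local Euler characteristic PROVED in the tree) and at the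
modified places (§1 of `…KolyvaginJumpAdapter`), `hw : p² < #H¹(K_λ, E[p])` (akr-p1 g3), `hincl`.

HONEST FRAMING: one theorem; 0 definitions, 0 named facts, 0 `sorry`; CONDITIONAL on the named PT fact and on the two
local inputs; closes nothing.

References: [cite: WZhang2014, Lemma 8.2] [cite: McCallumLMS1991, Prop. 2.1 (p. 296)] [cite: MilneADT2006, Ch. I,
Cor. 2.3, Thm. 2.8, Cor. 3.4, Thm. 4.10, Lemma 6.15] [cite: Howard2004HeegnerKolyvagin, Def. 2.1.10, Thm. 2.1.11]
[cite: PoonenRains2012, Prop. 4.10] [cite: BertoliniDarmon2005, §2.2–§2.3].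
-/

-- single-conjunct summit: `Summit.BirchSwinnertonDyer.BirchSwinnertonDyer.…` repeats the name by design
set_option linter.dupNamespace false

noncomputable section

open scoped Classical NumberField
open Function NumberField IsDedekindDomain Field WeierstrassCurve
open Literature.NumberTheory.EllipticCurves Literature.NumberTheory.EllipticCurves.ModularForms
open Literature.NumberTheory.GaloisRepresentations Literature.NumberTheory.GaloisRepresentations.DiscreteGaloisModule
  Literature.NumberTheory.GaloisCohomology
open Summit.BirchSwinnertonDyer.Rank1Residual.X11b.FiniteDuality
open Summit.BirchSwinnertonDyer.Rank1Residual.X11b.Relaxation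
open Summit.BirchSwinnertonDyer.Rank1Residual.X11b
open Summit.BirchSwinnertonDyer.Rank1Residual.GaloisImage
open Summit.BirchSwinnertonDyer.Rank1Residual.X11b.Three.Koly.ZhangSupply
open Summit.BirchSwinnertonDyer.Rank1Residual.X11b.Three.Koly.Method2

namespace Summit.BirchSwinnertonDyer.BirchSwinnertonDyer.Theorems.AdditiveKoly

variable (W : WeierstrassCurve ℚ) (K : Type) [Field K] [NumberField K] (p : ℕ) [W.IsElliptic] [W.IsGloballyMinimal]
  [Fact p.Prime] (ι : K →+* ℂ)
  -- cup products need the compactness of the local absolute Galois groups (binder, discharged by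
  -- `absoluteGaloisGroup_compactSpace` at the call site)
  [∀ v : Place K, CompactSpace (absoluteGaloisGroup (Place.Completion v))]

/-- **`hjump` from (Lag-tor) + (Lag-tr) modulo Poitou–Tate, general `p`.** See the module docstring. Binders: `hK`;
the named PT fact `hPT`; the places `plK` (`hplK`); the families `Ltor`, `Ltr` of genuine local conditions with isotropy
for the local Weil cup product of EVERY Weil-type pairing on `E[p]`, the lower count `#H¹ ≤ #L · #L`, and the one-sided
dictionary with `toricLocalKer` (above every Bertolini–Darmon admissible `q`) ∕ `transverseLocalKerP` (at the `plK ℓ'`).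
Conclusion: the binder `hjump` of the signed supply at general `p`, for every non-empty level. [cite: WZhang2014,
Lemma 8.2] [cite: McCallumLMS1991, Prop. 2.1] [cite: MilneADT2006, Ch. I, Thm. 4.10, Cor. 3.4] -/
theorem hjump_of_localLagrangiansP (hK : IsImaginaryQuadratic K) (hPT : poitouTate_selmerStructure_duality K)
    (plK : {ℓ // Zhang2014.IsKolyvaginPrime (W.conductorNorm ℤ) W K p ℓ} → HeightOneSpectrum (𝓞 K))
    (hplK : ∀ ℓ, ((ℓ : ℕ) : 𝓞 K) ∈ (plK ℓ).asIdeal)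
    (Ltor Ltr : (v : HeightOneSpectrum (𝓞 K)) →
      AddSubgroup (galoisCohomology (((W.baseChange K).torsionGaloisModule ((p ^ 1 : ℕ) : ℤ)).toLocal (Sum.inr v)) 1))
    (htorIso : ∀ (q : AdmQ W K p) (v : HeightOneSpectrum (𝓞 K)), ((q : ℕ) : 𝓞 K) ∈ v.asIdeal →
      ∀ (e : geomTorsion (W.baseChange K) ((p ^ 1 : ℕ) : ℤ) → geomTorsion (W.baseChange K) ((p ^ 1 : ℕ) : ℤ) →
          AlgebraicClosure K)
        (hμ : ∀ P Q, e P Q ^ (p ^ 1) = 1) (hadd₁ : ∀ P₁ P₂ Q, e (P₁ + P₂) Q = e P₁ Q * e P₂ Q)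
        (hadd₂ : ∀ P Q₁ Q₂, e P (Q₁ + Q₂) = e P Q₁ * e P Q₂) (_halt : ∀ Q, e Q Q = 1)
        (_hnondeg : ∀ Q, (∀ P, e P Q = 1) → Q = 0)
        (hgal : ∀ (σ : absoluteGaloisGroup K) (P Q : geomTorsion (W.baseChange K) ((p ^ 1 : ℕ) : ℤ)),
          σ • e P Q = e (σ • P) (σ • Q)),
      ∀ a ∈ Ltor v, ∀ b ∈ Ltor v,
        (weilContPairingLocal (W.baseChange K) (p ^ 1) e hμ hadd₁ hadd₂ hgal (Sum.inr v)).cupProduct a b = 0)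
    (htorCard : ∀ (q : AdmQ W K p) (v : HeightOneSpectrum (𝓞 K)), ((q : ℕ) : 𝓞 K) ∈ v.asIdeal →
      Nat.card (galoisCohomology (((W.baseChange K).torsionGaloisModule ((p ^ 1 : ℕ) : ℤ)).toLocal (Sum.inr v)) 1) ≤
        Nat.card (Ltor v) * Nat.card (Ltor v))
    (htorIncl : ∀ (q : AdmQ W K p) (v : HeightOneSpectrum (𝓞 K)), ((q : ℕ) : 𝓞 K) ∈ v.asIdeal → ∀ x : Vp W K p,
      galoisCohomology.localization ((W.baseChange K).torsionGaloisModule ((p ^ 1 : ℕ) : ℤ)) (Sum.inr v) 1 x ∈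
        Ltor v → x ∈ toricLocalKer (W.baseChange K) (v.adicCompletion K) ((p ^ 1 : ℕ) : ℤ))
    (htrIso : ∀ (ℓ' : {ℓ // Zhang2014.IsKolyvaginPrime (W.conductorNorm ℤ) W K p ℓ})
      (e : geomTorsion (W.baseChange K) ((p ^ 1 : ℕ) : ℤ) → geomTorsion (W.baseChange K) ((p ^ 1 : ℕ) : ℤ) →
          AlgebraicClosure K)
        (hμ : ∀ P Q, e P Q ^ (p ^ 1) = 1) (hadd₁ : ∀ P₁ P₂ Q, e (P₁ + P₂) Q = e P₁ Q * e P₂ Q)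
        (hadd₂ : ∀ P Q₁ Q₂, e P (Q₁ + Q₂) = e P Q₁ * e P Q₂) (_halt : ∀ Q, e Q Q = 1)
        (_hnondeg : ∀ Q, (∀ P, e P Q = 1) → Q = 0)
        (hgal : ∀ (σ : absoluteGaloisGroup K) (P Q : geomTorsion (W.baseChange K) ((p ^ 1 : ℕ) : ℤ)),
          σ • e P Q = e (σ • P) (σ • Q)),
      ∀ a ∈ Ltr (plK ℓ'), ∀ b ∈ Ltr (plK ℓ'),
        (weilContPairingLocal (W.baseChange K) (p ^ 1) e hμ hadd₁ hadd₂ hgal (Sum.inr (plK ℓ'))).cupProduct a b = 0)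
    (htrCard : ∀ (ℓ' : {ℓ // Zhang2014.IsKolyvaginPrime (W.conductorNorm ℤ) W K p ℓ}),
      Nat.card (galoisCohomology (((W.baseChange K).torsionGaloisModule ((p ^ 1 : ℕ) : ℤ)).toLocal
          (Sum.inr (plK ℓ'))) 1) ≤ Nat.card (Ltr (plK ℓ')) * Nat.card (Ltr (plK ℓ')))
    (htrIncl : ∀ (ℓ' : {ℓ // Zhang2014.IsKolyvaginPrime (W.conductorNorm ℤ) W K p ℓ}) (x : Vp W K p),
      galoisCohomology.localization ((W.baseChange K).torsionGaloisModule ((p ^ 1 : ℕ) : ℤ)) (Sum.inr (plK ℓ')) 1 x ∈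
        Ltr (plK ℓ') → x ∈ transverseLocalKerP W K p ι ℓ' (plK ℓ')) :
    ∀ (n : Finset (AdmQ W K p)), n.Nonempty →
      ∀ (ℓ : {ℓ // Zhang2014.IsKolyvaginPrime (W.conductorNorm ℤ) W K p ℓ}) (T : Finset _), ℓ ∉ T →
      ∀ x₀ : Vp W K p, ∃ x : Vp W K p,
        ((∀ w : InfinitePlace K, x ∈ selmerLocalKer (W.baseChange K) w.Completion ((p ^ 1 : ℕ) : ℤ)) ∧
          (∀ v : HeightOneSpectrum (𝓞 K), v ≠ plK ℓ → (∀ ℓ' ∈ T, plK ℓ' ≠ v) →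
            ((∀ q ∈ n, ((q : ℕ) : 𝓞 K) ∉ v.asIdeal) →
              x ∈ selmerLocalKer (W.baseChange K) (v.adicCompletion K) ((p ^ 1 : ℕ) : ℤ)) ∧
            (∀ q ∈ n, ((q : ℕ) : 𝓞 K) ∈ v.asIdeal →
              x ∈ toricLocalKer (W.baseChange K) (v.adicCompletion K) ((p ^ 1 : ℕ) : ℤ))) ∧
          (∀ ℓ' ∈ T, x ∈ transverseLocalKerP W K p ι ℓ' (plK ℓ'))) ∧
        ∀ a : ℤ, x - a • x₀ ∉ (W.baseChange K).torsionLocalKer ((plK ℓ).adicCompletion K) ((p ^ 1 : ℕ) : ℤ) := by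
  intro n _hn ℓ T hℓT
  have hp : p.Prime := Fact.out
  haveI : NeZero (p ^ 1 : ℕ) := ⟨pow_ne_zero 1 hp.ne_zero⟩
  haveI : IsTotallyComplex K := hK.2
  -- instances for the global cup product ∕ the Tate dual `μ_p`
  haveI : CompactSpace (absoluteGaloisGroup K) := absoluteGaloisGroup_compactSpace K
  haveI : Finite (Literature.NumberTheory.GaloisRepresentations.DiscreteGaloisModule.MuCarrier K (p ^ 1)) :=
    Literature.NumberTheory.EllipticCurves.finite_muCarrier (p ^ 1) K
  have hKc : ∀ w : InfinitePlace K, w.IsComplex := fun w ↦ IsTotallyComplex.isComplex w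
  -- a Weil pairing on `E[p]` and the Poitou–Tate family at level `p`
  have h2p : 2 ≤ p ^ 1 := by rw [pow_one]; exact hp.two_le
  obtain ⟨e, hμ, hadd₁, hadd₂, halt, hnondeg, hgal⟩ :=
    exists_weilPairing_holds (W.baseChange K) (p ^ 1) h2p (by exact_mod_cast pow_ne_zero 1 hp.ne_zero)
  obtain ⟨inv, hperf, hsum, -, hcompl⟩ := hPT (p ^ 1)
  have hinj : ∀ v : HeightOneSpectrum (𝓞 K), Injective (inv (Sum.inr v)) := fun v ↦ (hperf v).1.1
  -- separation of the places: `λ ∉ plK(T)`, no Kolyvagin place lies above a prime of the level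
  have hKK : ∀ ℓ' ∈ T, plK ℓ' ≠ plK ℓ := by
    intro ℓ' hℓ' h
    have hne : (ℓ' : ℕ) ≠ ℓ := fun h' ↦ hℓT (Subtype.ext h' ▸ hℓ')
    have hcop : Nat.Coprime (ℓ : ℕ) (ℓ' : ℕ) := (Nat.coprime_primes ℓ.2.1 ℓ'.2.1).mpr (Ne.symm hne)
    exact not_mem_asIdeal_of_coprime K hcop (plK ℓ) (hplK ℓ) (h ▸ hplK ℓ')
  have hKU : ∀ (ℓ' : {ℓ // Zhang2014.IsKolyvaginPrime (W.conductorNorm ℤ) W K p ℓ}) (q : AdmQ W K p),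
      ((q : ℕ) : 𝓞 K) ∉ (plK ℓ').asIdeal :=
    fun ℓ' q ↦ not_mem_of_kolyvagin_place_P W K p q ℓ'.2 (plK ℓ') (hplK ℓ')
  -- the exceptional finite set `T'` of finite places: above `p`, bad, `λ`, `plK(T)`, above the level
  have hp0 : (Ideal.span {((p : ℕ) : 𝓞 K)} : Ideal (𝓞 K)) ≠ 0 := by
    rw [Ne, Ideal.zero_eq_bot, Ideal.span_singleton_eq_bot]
    exact_mod_cast hp.ne_zero
  have hpfin : {v : HeightOneSpectrum (𝓞 K) | ((p : ℕ) : 𝓞 K) ∈ v.asIdeal}.Finite :=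
    (Ideal.finite_factors hp0).subset fun v hv ↦ (Ideal.dvd_span_singleton).mpr hv
  have hbadfin : {v : HeightOneSpectrum (𝓞 K) | ¬ (W.baseChange K).HasGoodReductionAt v}.Finite := by
    have h := (W.baseChange K).eventually_hasGoodReductionAt
    rwa [Filter.eventually_cofinite] at h
  have hnfin : {v : HeightOneSpectrum (𝓞 K) | ∃ q ∈ n, ((q : ℕ) : 𝓞 K) ∈ v.asIdeal}.Finite := by
    have hq : ∀ q : AdmQ W K p, {v : HeightOneSpectrum (𝓞 K) | ((q : ℕ) : 𝓞 K) ∈ v.asIdeal}.Finite := by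
      intro q
      have hq0 : (Ideal.span {((q : ℕ) : 𝓞 K)} : Ideal (𝓞 K)) ≠ 0 := by
        rw [Ne, Ideal.zero_eq_bot, Ideal.span_singleton_eq_bot]
        exact_mod_cast q.2.1.ne_zero
      exact (Ideal.finite_factors hq0).subset fun v hv ↦ (Ideal.dvd_span_singleton).mpr hv
    refine ((n : Set (AdmQ W K p)).toFinite.biUnion fun q _ ↦ hq q).subset ?_
    intro v hv
    obtain ⟨q, hqn, hqv⟩ := hv
    exact Set.mem_biUnion (Finset.mem_coe.mpr hqn) hqv
  set T' : Finset (HeightOneSpectrum (𝓞 K)) :=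
    hpfin.toFinset ∪ hbadfin.toFinset ∪ {plK ℓ} ∪ T.image plK ∪ hnfin.toFinset with hT'
  have hpT' : ∀ v : HeightOneSpectrum (𝓞 K), ((p : ℕ) : 𝓞 K) ∈ v.asIdeal → v ∈ T' := fun v hv ↦ by
    apply Finset.mem_union_left; apply Finset.mem_union_left; apply Finset.mem_union_left
    apply Finset.mem_union_left
    exact hpfin.mem_toFinset.mpr hv
  have hbadT' : ∀ v : HeightOneSpectrum (𝓞 K), ¬ (W.baseChange K).HasGoodReductionAt v → v ∈ T' := fun v hv ↦ by
    apply Finset.mem_union_left; apply Finset.mem_union_left; apply Finset.mem_union_left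
    apply Finset.mem_union_right
    exact hbadfin.mem_toFinset.mpr hv
  have hlamT' : plK ℓ ∈ T' := by
    apply Finset.mem_union_left; apply Finset.mem_union_left; apply Finset.mem_union_right
    exact Finset.mem_singleton_self _
  have hTT' : ∀ ℓ' ∈ T, plK ℓ' ∈ T' := fun ℓ' hℓ' ↦ by
    apply Finset.mem_union_left; apply Finset.mem_union_right
    exact Finset.mem_image_of_mem plK hℓ'
  have hnT' : ∀ v : HeightOneSpectrum (𝓞 K), ∀ q ∈ n, ((q : ℕ) : 𝓞 K) ∈ v.asIdeal → v ∈ T' := fun v q hq hqv ↦ by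
    apply Finset.mem_union_right
    exact hnfin.mem_toFinset.mpr ⟨q, hq, hqv⟩
  have houtp : ∀ v : HeightOneSpectrum (𝓞 K), v ∉ T' → ((p : ℕ) : 𝓞 K) ∉ v.asIdeal := fun v hv h ↦ hv (hpT' v h)
  have houtgood : ∀ v : HeightOneSpectrum (𝓞 K), v ∉ T' → (W.baseChange K).HasGoodReductionAt v := fun v hv ↦ by
    by_contra h
    exact hv (hbadT' v h)
  have houtlam : ∀ v : HeightOneSpectrum (𝓞 K), v ∉ T' → v ≠ plK ℓ := fun v hv h ↦ hv (h ▸ hlamT')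
  have houtT : ∀ v : HeightOneSpectrum (𝓞 K), v ∉ T' → ¬ ∃ ℓ' ∈ T, plK ℓ' = v :=
    fun v hv ⟨ℓ', hℓ', h⟩ ↦ hv (h ▸ hTT' ℓ' hℓ')
  have houtn : ∀ v : HeightOneSpectrum (𝓞 K), v ∉ T' → ¬ ∃ q ∈ n, ((q : ℕ) : 𝓞 K) ∈ v.asIdeal :=
    fun v hv ⟨q, hq, hqv⟩ ↦ hv (hnT' v q hq hqv)
  -- the two structures: `s = true` relaxed at `λ`, `s = false` strict at `λ`
  set 𝓚 : SelmerStructure ((W.baseChange K).torsionGaloisModule ((p ^ 1 : ℕ) : ℤ)) :=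
    (W.baseChange K).kummerSelmerStructure ((p ^ 1 : ℕ) : ℤ) with h𝓚
  let str : Bool → SelmerStructure ((W.baseChange K).torsionGaloisModule ((p ^ 1 : ℕ) : ℤ)) := fun s v ↦
    match v with
    | Sum.inl w => 𝓚 (Sum.inl w)
    | Sum.inr v =>
      if v = plK ℓ then (bif s then ⊤ else ⊥)
      else if (∃ ℓ' ∈ T, plK ℓ' = v) then Ltr v
      else if (∃ q ∈ n, ((q : ℕ) : 𝓞 K) ∈ v.asIdeal) then Ltor v
      else 𝓚 (Sum.inr v)
  have hstr_inl : ∀ s (w : InfinitePlace K), str s (Sum.inl w) = 𝓚 (Sum.inl w) := fun _ _ ↦ rfl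
  have hstr_inr : ∀ s (v : HeightOneSpectrum (𝓞 K)), str s (Sum.inr v) =
      if v = plK ℓ then (bif s then ⊤ else ⊥)
      else if (∃ ℓ' ∈ T, plK ℓ' = v) then Ltr v
      else if (∃ q ∈ n, ((q : ℕ) : 𝓞 K) ∈ v.asIdeal) then Ltor v
      else 𝓚 (Sum.inr v) := fun _ _ ↦ rfl
  have hstr_lam : ∀ s, str s (Sum.inr (plK ℓ)) = (bif s then ⊤ else ⊥) := fun s ↦ by
    rw [hstr_inr, if_pos rfl]
  have hstr_T : ∀ s, ∀ ℓ' ∈ T, str s (Sum.inr (plK ℓ')) = Ltr (plK ℓ') := fun s ℓ' hℓ' ↦ by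
    rw [hstr_inr, if_neg (hKK ℓ' hℓ'), if_pos ⟨ℓ', hℓ', rfl⟩]
  have hstr_n : ∀ s (v : HeightOneSpectrum (𝓞 K)), v ≠ plK ℓ → (∀ ℓ' ∈ T, plK ℓ' ≠ v) →
      ∀ q ∈ n, ((q : ℕ) : 𝓞 K) ∈ v.asIdeal → str s (Sum.inr v) = Ltor v := fun s v hv hvT q hq hqv ↦ by
    rw [hstr_inr, if_neg hv, if_neg (fun ⟨ℓ', hℓ', h⟩ ↦ hvT ℓ' hℓ' h), if_pos ⟨q, hq, hqv⟩]
  have hstr_K : ∀ s (v : HeightOneSpectrum (𝓞 K)), v ≠ plK ℓ → (¬ ∃ ℓ' ∈ T, plK ℓ' = v) →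
      (¬ ∃ q ∈ n, ((q : ℕ) : 𝓞 K) ∈ v.asIdeal) → str s (Sum.inr v) = 𝓚 (Sum.inr v) := fun s v hv hvT hvn ↦ by
    rw [hstr_inr, if_neg hv, if_neg hvT, if_neg hvn]
  have hstr_out : ∀ s (v : HeightOneSpectrum (𝓞 K)), v ∉ T' → str s (Sum.inr v) = 𝓚 (Sum.inr v) :=
    fun s v hv ↦ hstr_K s v (houtlam v hv) (houtT v hv) (houtn v hv)
  -- the side conditions
  have hS : ∀ v : HeightOneSpectrum (𝓞 K), v ∉ T' → (((p ^ 1 : ℕ) : ℕ) : 𝓞 K) ∉ v.asIdeal ∧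
      GaloisRep.IsUnramifiedAt v ((W.baseChange K).torsionGaloisModule (p ^ 1 : ℕ)) := by
    intro v hv
    have h3 : ((p ^ 1 : ℕ) : 𝓞 K) ∉ v.asIdeal := by
      rw [pow_one]
      exact houtp v hv
    refine ⟨h3, ?_⟩
    exact AcSelmer.isUnramifiedAt_torsionGaloisModule (W.baseChange K) (houtgood v hv)
      (n := ((p ^ 1 : ℕ) : ℤ)) (by rw [Int.cast_natCast]; exact h3)
  have hunr : ∀ s, (str s).IsUnramifiedOutside (finSupport T') := by
    intro s
    refine ⟨fun w ↦ inl_mem_finSupport T' w, fun v hv ↦ ?_⟩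
    rw [inr_mem_finSupport_iff] at hv
    rw [hstr_out s v hv, h𝓚]
    exact KummerPT.kummerSelmerStructure_inr_eq_unramifiedSubgroup (W.baseChange K) p 1
      (by exact_mod_cast houtp v hv) (houtgood v hv)
  have heq : ∀ v : Place K, v ≠ Sum.inr (plK ℓ) → str false v = str true v := by
    intro v hv
    rcases v with w | v
    · rfl
    · have hv' : v ≠ plK ℓ := fun h ↦ hv (h ▸ rfl)
      rw [hstr_inr, hstr_inr, if_neg hv', if_neg hv']
  have hstrict : str false (Sum.inr (plK ℓ)) = ⊥ := hstr_lam false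
  have hrelax : str true (Sum.inr (plK ℓ)) = ⊤ := hstr_lam true
  -- finiteness: `H¹_{str false} ⊆ H¹_{𝓚 relaxed on S(T')} = kummerOutside`
  have hfin : Finite (str false).selmerGroup := by
    have hle : (str false).selmerGroup ≤
        (KummerPT.kummerRelaxed (W.baseChange K) (p ^ 1) (finSupport T')).selmerGroup := by
      intro x hx
      rw [SelmerStructure.mem_selmerGroup_iff] at hx ⊢
      intro v
      rcases v with w | v
      · rw [KummerPT.kummerRelaxed_of_mem _ _ _ (inl_mem_finSupport T' w)]
        exact AddSubgroup.mem_top _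
      · by_cases hvT : v ∈ T'
        · rw [KummerPT.kummerRelaxed_of_mem _ _ _ ((inr_mem_finSupport_iff T' v).mpr hvT)]
          exact AddSubgroup.mem_top _
        · rw [KummerPT.kummerRelaxed_of_not_mem _ _ _ (fun h ↦ hvT ((inr_mem_finSupport_iff T' v).mp h))]
          have h := hx (Sum.inr v)
          rw [hstr_out false v hvT, h𝓚] at h
          exact h
    haveI : Finite (KummerPT.kummerRelaxed (W.baseChange K) (p ^ 1) (finSupport T')).selmerGroup := by
      rw [KummerPT.selmerGroup_kummerRelaxed]
      exact SelmerLevelBound.finite_kummerOutside (W.baseChange K) (p ^ 1) (finSupport T')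
    exact Finite.of_injective (AddSubgroup.inclusion hle) (AddSubgroup.inclusion_injective hle)
  -- the Lagrangian property off `λ`
  have hp1 : IsPrimePow (p ^ 1 : ℕ) := hp.isPrimePow.pow one_ne_zero
  have hEP : ∀ v : HeightOneSpectrum (𝓞 K), localEulerPoincareCharacteristic (v.adicCompletion K) := fun v ↦ by
    haveI : CharZero (v.adicCompletion K) := charZero_of_injective_algebraMap (algebraMap K _).injective
    exact localEulerPoincareCharacteristic_holds (v.adicCompletion K)
  have hmaxK : ∀ v : Place K, annRight (invWeilPairing (W.baseChange K) (p ^ 1 : ℕ) e hμ hadd₁ hadd₂ hgal inv v)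
      (𝓚 v) = 𝓚 v := fun v ↦ by
    rw [h𝓚]
    exact KummerDuality.annRight_invWeilPairing_kummerSelmerStructure_eq (W.baseChange K) (p ^ 1) e hμ hadd₁ hadd₂
      hgal halt hnondeg inv hKc hp1 hperf hEP v
  have hmax : ∀ v : Place K, v ≠ Sum.inr (plK ℓ) →
      annRight (invWeilPairing (W.baseChange K) (p ^ 1 : ℕ) e hμ hadd₁ hadd₂ hgal inv v) (str false v) =
        str false v := by
    intro v hv
    rcases v with w | v
    · rw [hstr_inl false w]
      exact hmaxK (Sum.inl w)
    · have hv' : v ≠ plK ℓ := fun h ↦ hv (h ▸ rfl)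
      by_cases hvT : ∃ ℓ' ∈ T, plK ℓ' = v
      · obtain ⟨ℓ', hℓ', rfl⟩ := hvT
        rw [hstr_T false ℓ' hℓ']
        exact annRight_invWeilPairing_eq_of_isotropic_of_card_le (W.baseChange K) (p ^ 1) e hμ hadd₁ hadd₂ hgal
          hnondeg inv (plK ℓ') (hinj _) (Ltr (plK ℓ')) (htrIso ℓ' e hμ hadd₁ hadd₂ halt hnondeg hgal) (htrCard ℓ')
      · by_cases hvn : ∃ q ∈ n, ((q : ℕ) : 𝓞 K) ∈ v.asIdeal
        · obtain ⟨q, hq, hqv⟩ := hvn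
          rw [hstr_n false v hv' (fun ℓ' hℓ' h ↦ hvT ⟨ℓ', hℓ', h⟩) q hq hqv]
          exact annRight_invWeilPairing_eq_of_isotropic_of_card_le (W.baseChange K) (p ^ 1) e hμ hadd₁ hadd₂ hgal
            hnondeg inv v (hinj v) (Ltor v) (htorIso q v hqv e hμ hadd₁ hadd₂ halt hnondeg hgal) (htorCard q v hqv)
        · rw [hstr_K false v hv' hvT hvn]
          exact hmaxK (Sum.inr v)
  -- `p² < #H¹(K_λ, E[p])`
  have hw := sq_lt_natCard_galoisCohomology_one_toLocal_of_kolyvagin_P W K p hK ℓ.2 (plK ℓ) (hplK ℓ)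
  -- the dictionary `H¹_{str true} ⊆ G(n, ℓ, T)`
  have hincl := selmerGroup_subset_relaxedGroupP W K p ι plK n ℓ T (str true)
    (fun w ↦ by rw [hstr_inl true w, h𝓚, WeierstrassCurve.kummerSelmerStructure_apply]; exact le_rfl)
    (fun v hv hvT hvn ↦ by
      rw [hstr_K true v hv (fun ⟨ℓ', hℓ', h⟩ ↦ hvT ℓ' hℓ' h) (fun ⟨q, hq, hqv⟩ ↦ hvn q hq hqv), h𝓚,
        WeierstrassCurve.kummerSelmerStructure_apply]
      exact le_rfl)
    (fun v hv hvT q hq hqv x hx ↦ by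
      rw [hstr_n true v hv hvT q hq hqv] at hx
      exact htorIncl q v hqv x hx)
    (fun ℓ' hℓ' x hx ↦ by
      rw [hstr_T true ℓ' hℓ'] at hx
      exact htrIncl ℓ' x hx)
  exact hjump_of_lagrangianP W K p ι plK n ℓ T e hμ hadd₁ hadd₂ hgal hnondeg inv hperf hsum hcompl T' hS (hunr false)
    (hunr true) ⟨plK ℓ, hlamT'⟩ rfl heq hstrict hrelax hfin hmax hw hincl

end Summit.BirchSwinnertonDyer.BirchSwinnertonDyer.Theorems.AdditiveKoly

end
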